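import Mathlib
import Literature.NumberTheory.Automorphic.ToricPseudoEisensteinSeries
import Literature.NumberTheory.Automorphic.ToricPseudoEisensteinUnfolding
import HarnessLib

/-!
# The regular representation on `L²(G ⧸ Γ)` and pseudo-Eisenstein vectors

Topic `NumberTheory/Automorphic`; namespace `Literature.NumberTheory.Automorphic.RegularRep`.

The right regular representation of `G` on `L²(Γ\G)` is unitary, and the pseudo-Eisenstein series
`E^χ_f`, `f ∈ C_c(G)`, are vectors of `L²(Γ\G)` (continuous, compactly supported modulo `Γ`
[Garrett2018, Claim 1.8.1]) whose family is stable under right translation,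
`R(h₀) E^χ_f = E^χ_{f(· h₀)}`; hence the closed span of the pseudo-Eisenstein vectors is an
invariant subspace [MoeglinWaldspurger1995, II.1.10–II.1.12]. This file builds the standard
`L²`-model of these facts over Mathlib's coset space:

* §1 `koopman μ : G →* (Lp ℂ 2 μ →L[ℂ] Lp ℂ 2 μ)`, `R(g) v = v ∘ (g⁻¹ • ·)`, for a measure-preserving
  action (`SMulInvariantMeasure G Y μ`) — a linear isometry (`Lp.compMeasurePreservingₗᵢ`), hence
  `koopman_inner : ⟪R g u, R g v⟫ = ⟪u, v⟫`; `koopman_eq_domMulAct_smul` identifies it with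
  Mathlib's `DomMulAct` action on `Lp` (`R(g) v = DomMulAct.mk g⁻¹ • v`);
* §2 `descend Γ u` : a LEFT-`Γ`-invariant function on `G` (a function on `Γ\G`) descended to
  Mathlib's `G ⧸ Γ` (cosets `yΓ`, left action `g • yΓ = (g y)Γ`) along `Γy ↦ y⁻¹Γ`, which carries
  right translation `(R(h)u)(Γy) = u(Γ y h)` to `v ↦ v ∘ (h⁻¹ • ·)`; continuity and compact support
  descend;
* §3 `discreteMeets_of_discrete` : a discrete closed subgroup meets every compact set in a finite set
  (the hypothesis `PseudoEisenstein.DiscreteMeets` of `ToricPseudoEisensteinSeries`);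
* §4 `EisQ`, `EisL2 μQ ν jT β χ hΓ f ∈ Lp ℂ 2 μQ` : the toric pseudo-Eisenstein series
  `PseudoEisenstein.Eis` of `ToricPseudoEisensteinSeries` descended to `G ⧸ Γ` and promoted to an
  `L²` class for a measure `μQ` finite on compacts (`Continuous.memLp_of_hasCompactSupport`);
  `rTransCc f h₀ ∈ C_c(G, ℂ)` the right translate; `koopman_EisL2 : R(h₀) E^χ_f = E^χ_{f^{h₀}}`
  (from `PseudoEisenstein.Eis_rTrans`) for `μQ` `G`-invariant; `koopman_mem_closureSpan_EisL2` : the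
  closed span of the pseudo-Eisenstein vectors is `R(G)`-invariant
  (`PseudoEisenstein.closureSpan_invariant`).

For `G` unimodular and `Γ` discrete, `μQ` is the Haar quotient measure (Mathlib
`MeasureTheory.QuotientMeasureEqMeasurePreimage.smulInvariantMeasure_quotient`). Hypotheses are
structural only: `Γ` a discrete closed subgroup, `μQ` invariant and finite on compacts, the torus
data (`T`, `ν`, `jT`, `β`, `χ`) continuous / compactly supported as in `ToricPseudoEisensteinSeries`.

Provenance: HodgeCM PerL cell `pub-hodgecm`, package file
`HodgeCM/Automorphic/RegularRepresentation.lean` (seat pv15-g2, gate run 24), ported to the tree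
under the LEAN-IN-TREE rule by seat pv15-g7 (names `HodgeCM.RegularRep.X` ↦
`Literature.NumberTheory.Automorphic.RegularRep.X`, statements verbatim).

## References

* P. Garrett, *Modern Analysis of Automorphic Forms by Example*, vol. 1 (2018), §1.8 (Claim 1.8.1),
  §6.1 (density of `C_c` in `L²(Γ\G)`) [Garrett2018].
* C. Moeglin, J.-L. Waldspurger, *Spectral Decomposition and Eisenstein Series* (1995),
  II.1.10–II.1.12 [MoeglinWaldspurger1995].
* A. Deitmar, S. Echterhoff, *Principles of Harmonic Analysis*, 2nd ed. (2014), §1.5 (invariant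
  measures on quotients) [DeitmarEchterhoff2014].
-/

noncomputable section

open _root_.MeasureTheory Set Filter Function
open scoped InnerProductSpace ENNReal CompactlySupported Pointwise

namespace Literature.NumberTheory.Automorphic

namespace RegularRep

/-! ## 1. The Koopman (regular) representation of a measure-preserving action on `L²` -/

section Koopman

variable {G Y : Type*} [Group G] [MulAction G Y] [MeasurableSpace Y] [MeasurableConstSMul G Y]
  (μ : Measure Y) [SMulInvariantMeasure G Y μ]

/-- `R(g) : v ↦ v ∘ (g⁻¹ • ·)` as a linear isometry of `L²(Y, μ)`. [folklore] -/
def koopmanₗᵢ (g : G) : Lp ℂ 2 μ →ₗᵢ[ℂ] Lp ℂ 2 μ :=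
  Lp.compMeasurePreservingₗᵢ ℂ (fun y : Y => g⁻¹ • y) (measurePreserving_smul g⁻¹ μ)

/-- Unfolding `koopmanₗᵢ`. [folklore] -/
theorem koopmanₗᵢ_apply (g : G) (v : Lp ℂ 2 μ) :
    koopmanₗᵢ μ g v = Lp.compMeasurePreserving (fun y : Y => g⁻¹ • y) (measurePreserving_smul g⁻¹ μ) v :=
  rfl

/-- `R(g) v` is a.e. `v ∘ (g⁻¹ • ·)`. [folklore] -/
theorem coeFn_koopmanₗᵢ (g : G) (v : Lp ℂ 2 μ) :
    (koopmanₗᵢ μ g v : Y → ℂ) =ᵐ[μ] fun y => v (g⁻¹ • y) :=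
  Lp.coeFn_compMeasurePreserving v _

/-- **The regular (Koopman) representation** `R : G →* (L²(Y, μ) →L[ℂ] L²(Y, μ))`,
`R(g) v = v ∘ (g⁻¹ • ·)`, of a measure-preserving action. [folklore] -/
def koopman : G →* (Lp ℂ 2 μ →L[ℂ] Lp ℂ 2 μ) where
  toFun g := (koopmanₗᵢ μ g).toContinuousLinearMap
  map_one' := by
    ext1 v
    change koopmanₗᵢ μ 1 v = v
    apply Lp.ext
    have h1 := coeFn_koopmanₗᵢ μ (1 : G) v
    have h2 : (fun y => (v : Y → ℂ) ((1 : G)⁻¹ • y)) = (v : Y → ℂ) := by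
      funext y
      rw [inv_one, one_smul]
    rw [h2] at h1
    exact h1
  map_mul' g h := by
    ext1 v
    change koopmanₗᵢ μ (g * h) v = koopmanₗᵢ μ g (koopmanₗᵢ μ h v)
    apply Lp.ext
    have h0 := coeFn_koopmanₗᵢ μ (g * h) v
    have h1 := coeFn_koopmanₗᵢ μ g (koopmanₗᵢ μ h v)
    have h2 : (fun y => (koopmanₗᵢ μ h v : Y → ℂ) (g⁻¹ • y))
        =ᵐ[μ] fun y => (fun z => (v : Y → ℂ) (h⁻¹ • z)) (g⁻¹ • y) :=
      (measurePreserving_smul g⁻¹ μ).quasiMeasurePreserving.ae_eq_comp (coeFn_koopmanₗᵢ μ h v)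
    have h3 : (fun y => (fun z => (v : Y → ℂ) (h⁻¹ • z)) (g⁻¹ • y))
        = fun y => (v : Y → ℂ) ((g * h)⁻¹ • y) := by
      funext y
      simp only [mul_inv_rev, mul_smul]
    rw [h3] at h2
    exact h0.trans (h1.trans h2).symm

/-- `koopman` is `koopmanₗᵢ` as a continuous linear map. [folklore] -/
theorem koopman_apply (g : G) (v : Lp ℂ 2 μ) : koopman μ g v = koopmanₗᵢ μ g v := rfl

/-- `R(g) v` is a.e. `v ∘ (g⁻¹ • ·)`. [folklore] -/
theorem coeFn_koopman (g : G) (v : Lp ℂ 2 μ) :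
    (koopman μ g v : Y → ℂ) =ᵐ[μ] fun y => v (g⁻¹ • y) :=
  coeFn_koopmanₗᵢ μ g v

/-- **Unitarity**: `R(g)` preserves inner products. [folklore] -/
theorem koopman_inner (g : G) (u v : Lp ℂ 2 μ) : ⟪koopman μ g u, koopman μ g v⟫_ℂ = ⟪u, v⟫_ℂ :=
  (koopmanₗᵢ μ g).inner_map_map u v

/-- `R(g)` is norm-preserving. [folklore] -/
theorem norm_koopman (g : G) (v : Lp ℂ 2 μ) : ‖koopman μ g v‖ = ‖v‖ :=
  (koopmanₗᵢ μ g).norm_map v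

/-- **Bridge to Mathlib's `DomMulAct` action on `Lp`**: `R(g) v = DomMulAct.mk g⁻¹ • v` — the same
operator, indexed by `G` instead of `Gᵈᵐᵃ`. [folklore] -/
theorem koopman_eq_domMulAct_smul (g : G) (v : Lp ℂ 2 μ) : koopman μ g v = DomMulAct.mk g⁻¹ • v := by
  apply Lp.ext
  have h := DomMulAct.smul_Lp_ae_eq (DomMulAct.mk g⁻¹) v
  simp only [Equiv.symm_apply_apply] at h
  exact (coeFn_koopman μ g v).trans h.symm

/-- `R(g)` on the class of a function is the class of the translated function. [folklore] -/
theorem koopman_toLp (g : G) {u : Y → ℂ} (hu : MemLp u 2 μ) :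
    koopman μ g (hu.toLp u)
      = (hu.comp_measurePreserving (measurePreserving_smul g⁻¹ μ)).toLp (u ∘ fun y : Y => g⁻¹ • y) :=
  Lp.toLp_compMeasurePreserving hu _

end Koopman

/-! ## 2. Descending left-`Γ`-invariant functions on `G` to the coset space `G ⧸ Γ` -/

section Descend

variable {G : Type*} [Group G] (Γ : Subgroup G)

/-- Descend a LEFT-`Γ`-invariant function `u` on `G` (a function on `Γ\G`) to Mathlib's `G ⧸ Γ`
along `Γy ↦ y⁻¹Γ`: `ǔ(xΓ) := u(x⁻¹)`. [folklore] -/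
def descend (u : G → ℂ) (hu : ∀ (γ : Γ) (y : G), u ((γ : G) * y) = u y) : G ⧸ Γ → ℂ :=
  Quotient.lift (fun x : G => u x⁻¹) fun a b hab => by
    have hmem : a⁻¹ * b ∈ Γ := QuotientGroup.leftRel_apply.mp hab
    have hb : b⁻¹ = ((⟨a⁻¹ * b, hmem⟩ : Γ)⁻¹ : Γ) * a⁻¹ := by
      simp [mul_inv_rev]
    change u a⁻¹ = u b⁻¹
    rw [hb, hu]

variable {Γ}

/-- `descend` on a coset representative. [folklore] -/
@[simp] theorem descend_mk (u : G → ℂ) (hu : ∀ (γ : Γ) (y : G), u ((γ : G) * y) = u y) (x : G) :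
    descend Γ u hu (QuotientGroup.mk x) = u x⁻¹ := rfl

/-- `descend` on the coset of an inverse. [folklore] -/
theorem descend_mk_inv (u : G → ℂ) (hu : ∀ (γ : Γ) (y : G), u ((γ : G) * y) = u y) (x : G) :
    descend Γ u hu (QuotientGroup.mk x⁻¹) = u x := by
  simp

/-- Support: if `u` vanishes off `Γ·S`, its descent vanishes off the image of `S⁻¹`. [folklore] -/
theorem descend_eq_zero_of_notMem (u : G → ℂ) (hu : ∀ (γ : Γ) (y : G), u ((γ : G) * y) = u y)
    {S : Set G} (hS : ∀ y, u y ≠ 0 → ∃ γ : Γ, (γ : G) * y ∈ S)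
    {q : G ⧸ Γ} (hq : q ∉ QuotientGroup.mk '' S⁻¹) : descend Γ u hu q = 0 := by
  induction q using QuotientGroup.induction_on with
  | H x =>
    by_contra hne
    obtain ⟨γ, hγ⟩ := hS x⁻¹ hne
    apply hq
    refine ⟨((γ : G) * x⁻¹)⁻¹, Set.inv_mem_inv.2 hγ, ?_⟩
    rw [QuotientGroup.eq]
    simp

variable [TopologicalSpace G] [IsTopologicalGroup G]

/-- The descent of a continuous invariant function is continuous. [folklore] -/
theorem continuous_descend {u : G → ℂ} (hc : Continuous u)
    (hu : ∀ (γ : Γ) (y : G), u ((γ : G) * y) = u y) : Continuous (descend Γ u hu) :=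
  (hc.comp continuous_inv).quotient_lift _

/-- The descent of a function supported on `Γ·S`, `S` compact, has compact support. [folklore] -/
theorem hasCompactSupport_descend [T2Space (G ⧸ Γ)] (u : G → ℂ)
    (hu : ∀ (γ : Γ) (y : G), u ((γ : G) * y) = u y)
    {S : Set G} (hSc : IsCompact S) (hS : ∀ y, u y ≠ 0 → ∃ γ : Γ, (γ : G) * y ∈ S) :
    HasCompactSupport (descend Γ u hu) :=
  HasCompactSupport.intro (hSc.inv.image QuotientGroup.continuous_mk)
    fun _ hq => descend_eq_zero_of_notMem u hu hS hq

end Descend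

/-! ## 3. Discrete closed subgroups meet compact sets in finite sets -/

section Discrete

variable {G : Type*} [Group G] [TopologicalSpace G]

/-- A discrete closed subgroup meets every compact set in a finite set
(`PseudoEisenstein.DiscreteMeets`). [folklore] -/
theorem discreteMeets_of_discrete (Γ : Subgroup G) [DiscreteTopology Γ] [hΓ : IsClosed (Γ : Set G)] :
    PseudoEisenstein.DiscreteMeets Γ := by
  intro C hC
  have hcpt : IsCompact (C ∩ (Γ : Set G)) := hC.inter_right hΓ
  have hdiscΓ : IsDiscrete (Γ : Set G) :=
    isDiscrete_iff_discreteTopology.mpr (inferInstanceAs (DiscreteTopology Γ))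
  have hfin : (C ∩ (Γ : Set G)).Finite := hcpt.finite (hdiscΓ.mono inter_subset_right)
  have : {γ : Γ | (γ : G) ∈ C} = (fun γ : Γ => (γ : G)) ⁻¹' (C ∩ (Γ : Set G)) := by
    ext γ
    simp
  rw [this]
  exact hfin.preimage Subtype.val_injective.injOn

end Discrete

/-! ## 4. Pseudo-Eisenstein vectors in `L²(G ⧸ Γ)` and the translation law -/

section Eis

open Literature.NumberTheory.Automorphic.PseudoEisenstein

variable {G : Type*} [Group G] {T : Type*} [Group T] [MeasurableSpace T]

/-- If `E^χ_f(y) ≠ 0` then `γ y ∈ jT(tsupport β) · tsupport f` for some `γ ∈ Γ`.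
[cite: Garrett2018, Claim 1.8.1] -/
theorem exists_mem_of_Eis_ne_zero [TopologicalSpace G] [TopologicalSpace T] (ν : Measure T)
    (jT : T →* G)
    (β : T → ℝ) (χ : T → ℂ) (Γ : Subgroup G) (f : G → ℂ) (y : G) (hy : Eis ν jT β χ Γ f y ≠ 0) :
    ∃ γ : Γ, (γ : G) * y ∈ ((jT : T → G) '' tsupport β) * tsupport f := by
  by_contra hcon
  push Not at hcon
  apply hy
  unfold Eis
  have h0 : ∀ γ : Γ, Xiβ ν jT β χ f ((γ : G) * y) = 0 := fun γ =>
    Xiβ_eq_zero_of_notMem ν jT β χ f (hcon γ)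
  simp [h0]

variable (Γ : Subgroup G)

/-- The toric pseudo-Eisenstein series `E^χ_f` as a function on the coset space `G ⧸ Γ` (via
`Γy ↦ y⁻¹Γ`). [cite: MoeglinWaldspurger1995, II.1.10] -/
def EisQ (ν : Measure T) (jT : T →* G) (β : T → ℝ) (χ : T → ℂ) (f : G → ℂ) : G ⧸ Γ → ℂ :=
  descend Γ (Eis ν jT β χ Γ f) (Eis_leftInvariant ν jT β χ Γ f)

variable {Γ}

/-- `EisQ` on a coset representative. [folklore] -/
@[simp] theorem EisQ_mk (ν : Measure T) (jT : T →* G) (β : T → ℝ) (χ : T → ℂ) (f : G → ℂ) (x : G) :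
    EisQ Γ ν jT β χ f (QuotientGroup.mk x) = Eis ν jT β χ Γ f x⁻¹ := rfl

/-- **Translation law on the coset space**: `E^χ_f ∘ (h₀⁻¹ • ·) = E^χ_{f^{h₀}}` (from
`PseudoEisenstein.Eis_rTrans`). [cite: Garrett2018, §1.8] -/
theorem EisQ_smul (ν : Measure T) (jT : T →* G) (β : T → ℝ) (χ : T → ℂ) (f : G → ℂ) (h₀ : G)
    (q : G ⧸ Γ) : EisQ Γ ν jT β χ f (h₀⁻¹ • q) = EisQ Γ ν jT β χ (rTrans f h₀) q := by
  induction q using QuotientGroup.induction_on with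
  | H x =>
    rw [MulAction.Quotient.smul_mk, smul_eq_mul, EisQ_mk, EisQ_mk, Eis_rTrans, mul_inv_rev, inv_inv]

variable [TopologicalSpace G] [IsTopologicalGroup G] [TopologicalSpace T]

/-- The right translate `f^{h₀}(x) = f(x h₀)` as a map of `C_c(G, ℂ)`. [folklore] -/
def rTransCc (f : C_c(G, ℂ)) (h₀ : G) : C_c(G, ℂ) where
  toFun := rTrans f h₀
  continuous_toFun := f.continuous.comp (continuous_id.mul continuous_const)
  hasCompactSupport' := by
    have h := f.hasCompactSupport.comp_homeomorph (Homeomorph.mulRight h₀)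
    have he : ((f : G → ℂ) ∘ (Homeomorph.mulRight h₀)) = rTrans f h₀ := by
      funext x
      simp [rTrans]
    rw [← he]
    exact h

/-- Evaluation of the right translate. [folklore] -/
@[simp] theorem rTransCc_apply (f : C_c(G, ℂ)) (h₀ x : G) : rTransCc f h₀ x = f (x * h₀) := rfl

/-- The right translate as a bare function is `PseudoEisenstein.rTrans`. [folklore] -/
theorem coe_rTransCc (f : C_c(G, ℂ)) (h₀ : G) : (rTransCc f h₀ : G → ℂ) = rTrans f h₀ := rfl

/-- `EisQ` is continuous (from `PseudoEisenstein.continuous_Eis`). [cite: Garrett2018, Claim 1.8.1] -/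
theorem continuous_EisQ [T2Space G] [LocallyCompactSpace G] [OpensMeasurableSpace T]
    (ν : Measure T) [IsFiniteMeasureOnCompacts ν] (jT : T →* G) (hjT : Continuous jT)
    (β : T → ℝ) (hβ : Continuous β) (hβs : HasCompactSupport β) (χ : T → ℂ) (hχ : Continuous χ)
    (hΓ : DiscreteMeets Γ) (f : G → ℂ) (hf : Continuous f) (hfs : HasCompactSupport f) :
    Continuous (EisQ Γ ν jT β χ f) :=
  continuous_descend (continuous_Eis ν jT hjT β hβ hβs χ hχ Γ hΓ f hf hfs) _

/-- `EisQ` has compact support on `G ⧸ Γ`. [cite: Garrett2018, Claim 1.8.1] -/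
theorem hasCompactSupport_EisQ [T2Space G] [T2Space (G ⧸ Γ)] (ν : Measure T) (jT : T →* G)
    (hjT : Continuous jT) (β : T → ℝ) (hβs : HasCompactSupport β) (χ : T → ℂ) (f : G → ℂ)
    (hfs : HasCompactSupport f) : HasCompactSupport (EisQ Γ ν jT β χ f) :=
  hasCompactSupport_descend _ _ ((hβs.isCompact.image hjT).mul hfs.isCompact)
    (exists_mem_of_Eis_ne_zero ν jT β χ Γ f)

variable [T2Space G] [LocallyCompactSpace G] [OpensMeasurableSpace T]
  [MeasurableSpace (G ⧸ Γ)] [BorelSpace (G ⧸ Γ)] [T2Space (G ⧸ Γ)]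
  (μQ : Measure (G ⧸ Γ)) [IsFiniteMeasureOnCompacts μQ]
  (ν : Measure T) [IsFiniteMeasureOnCompacts ν] (jT : ContinuousMonoidHom T G)
  (β : C_c(T, ℝ)) (χ : C(T, ℂ))

/-- `EisQ` is square-integrable for any measure finite on compacts. [folklore] -/
theorem memLp_EisQ (hΓ : DiscreteMeets Γ) (f : C_c(G, ℂ)) :
    MemLp (EisQ Γ ν jT.toMonoidHom β χ f) 2 μQ :=
  (continuous_EisQ ν jT.toMonoidHom jT.continuous β β.continuous β.hasCompactSupport χ χ.continuous hΓ
      f f.continuous f.hasCompactSupport).memLp_of_hasCompactSupport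
    (hasCompactSupport_EisQ ν jT.toMonoidHom jT.continuous β β.hasCompactSupport χ f f.hasCompactSupport)

/-- **The pseudo-Eisenstein VECTOR `E^χ_f ∈ L²(G ⧸ Γ)`**, for `f ∈ C_c(G, ℂ)`.
[cite: MoeglinWaldspurger1995, II.1.10] -/
def EisL2 (hΓ : DiscreteMeets Γ) (f : C_c(G, ℂ)) : Lp ℂ 2 μQ :=
  (memLp_EisQ μQ ν jT β χ hΓ f).toLp _

/-- The `L²` class `EisL2` is a.e. the function `EisQ`. [folklore] -/
theorem coeFn_EisL2 (hΓ : DiscreteMeets Γ) (f : C_c(G, ℂ)) :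
    (EisL2 μQ ν jT β χ hΓ f : G ⧸ Γ → ℂ) =ᵐ[μQ] EisQ Γ ν jT.toMonoidHom β χ f :=
  MemLp.coeFn_toLp _

variable [SMulInvariantMeasure G (G ⧸ Γ) μQ] [MeasurableSpace G] [BorelSpace G]

/-- **Translation law in the regular representation**: `R(h₀) E^χ_f = E^χ_{f^{h₀}}` in
`L²(G ⧸ Γ)`. [cite: Garrett2018, §1.8] -/
theorem koopman_EisL2 (hΓ : DiscreteMeets Γ) (h₀ : G) (f : C_c(G, ℂ)) :
    koopman μQ h₀ (EisL2 μQ ν jT β χ hΓ f) = EisL2 μQ ν jT β χ hΓ (rTransCc f h₀) := by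
  apply Lp.ext
  have h1 := coeFn_koopman μQ h₀ (EisL2 μQ ν jT β χ hΓ f)
  have h2 : (fun q : G ⧸ Γ => (EisL2 μQ ν jT β χ hΓ f : G ⧸ Γ → ℂ) (h₀⁻¹ • q))
      =ᵐ[μQ] fun q : G ⧸ Γ => EisQ Γ ν jT.toMonoidHom β χ f (h₀⁻¹ • q) :=
    (measurePreserving_smul h₀⁻¹ μQ).quasiMeasurePreserving.ae_eq_comp (coeFn_EisL2 μQ ν jT β χ hΓ f)
  have h3 := coeFn_EisL2 μQ ν jT β χ hΓ (rTransCc f h₀)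
  have h4 : (fun q : G ⧸ Γ => EisQ Γ ν jT.toMonoidHom β χ f (h₀⁻¹ • q))
      = EisQ Γ ν jT.toMonoidHom β χ (rTransCc f h₀) :=
    funext fun q => EisQ_smul ν jT.toMonoidHom β χ f h₀ q
  rw [h4] at h2
  exact h1.trans (h2.trans h3.symm)

/-- The closed span of the pseudo-Eisenstein vectors (over any family of characters `χv` and all
`f ∈ C_c(G, ℂ)`) is `R(G)`-invariant. [cite: MoeglinWaldspurger1995, II.1.12] -/
theorem koopman_mem_closureSpan_EisL2 (hΓ : DiscreteMeets Γ) {X : Type*} (χv : X → C(T, ℂ))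
    (h₀ : G)
    {v : Lp ℂ 2 μQ}
    (hv : v ∈ (Submodule.span ℂ
      (Set.range fun p : X × C_c(G, ℂ) => EisL2 μQ ν jT β (χv p.1) hΓ p.2)).topologicalClosure) :
    koopman μQ h₀ v ∈ (Submodule.span ℂ
      (Set.range fun p : X × C_c(G, ℂ) => EisL2 μQ ν jT β (χv p.1) hΓ p.2)).topologicalClosure := by
  refine closureSpan_invariant (koopman μQ h₀) _ ?_ hv
  rintro _ ⟨p, rfl⟩
  exact ⟨(p.1, rTransCc p.2 h₀), (koopman_EisL2 μQ ν jT β (χv p.1) hΓ h₀ p.2).symm⟩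

end Eis

end RegularRep

end Literature.NumberTheory.Automorphic

end
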